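import Literature.AnabelianGeometry.EtaleTheta.Discharge.Sec1Thm110iOfDecompTransport
import Literature.AnabelianGeometry.EtaleTheta.Discharge.Sec1Thm110iUniqueDeck
import Literature.AnabelianGeometry.EtaleTheta.Discharge.Sec1Def17Coverings
import HarnessLib

/-!
# [EtTh] Thm. 1.10: the matching of `τ⁻¹` FOLLOWS from that of `τ` and the deck relations
# (K2: rows r5 + r8″ joined; the typed `Thm110DecompTransport` suffices)

S. Mochizuki, *The étale theta function …*, Publ. RIMS 45 (2009), §1, Thm. 1.10 p.255–256, Def. 1.9 p.255
(«the 4-torsion point `τ⁻¹` determined by `−√−1`»), the `μ₂`-covering `Ÿ → Y` p.242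
[cite: MochizukiEtTh2009, Thm 1.10 p.29].  PROOF-ONLY sequel of `Sec1Thm110iOfDecompTransport.lean`
(p429307: `thm110i_of_matching`), `Sec1Thm110iUniqueDeck.lean` (p427524:
`AnchoredStandardData.evalAt_tauInv_eq_of_deck`) and abc-iut-L2-t6's `Sec1Def17Coverings.lean`
(`MuTwoSetting.relIndex_GtpYdd_GtpY`, `map_GtpXdd_le_dotX`).  K2 holder abc-iut-w5-d140.

In p428966/p429307 the decomposition-group transport was assumed for BOTH points `τ`, `τ⁻¹`.  Here the
`τ⁻¹`-half is DERIVED from the `τ`-half — the typed row-r5 statement `Thm110DecompTransport H Sα Sβ`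
(p417168) — and the DECK RELATIONS `D_{τ☐⁻¹} = ε☐⁻¹ D_{τ☐} ε☐` (`toZ ε☐ = 0`) on both sides (the r8″ input of
p425484): if `γ(D_{τα}) = σ D_{τβ^{±1}} σ⁻¹` then `γ(D_{τα⁻¹}) = s D_{τβ^{∓1}} s⁻¹` with
`s = γ(εα)⁻¹ σ εβ^{±1}`, and `s` lies over `Ẋβ` because BOTH deck elements are non-trivial modulo `Π^tp_Ÿ`
(`deck_not_mem_GtpYdd`: an anchored `τ⁻¹` on a `Π^tp_Ÿ`-conjugate of `D_τ` would have `Ü(τ⁻¹) = Ü(τ)`,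
i.e. `(√−1)² = 1`), `γ(εα) ∈ Π^tp_{Yβ}` (`ε² ∈ Π^tp_Ÿ`, Thm. 1.6 (i)), and `[Π^tp_Y : Π^tp_Ÿ] = 2`
(`K = K̈`).  Consequences: **`thm110ii_of_decompTransport_of_deck`**, **`thm110i_of_decompTransport_of_deck`**
— the typed F-0514/F-0512 from {`Thm110DeltaInduced`, (`Thm110DeltaCompat`), `Thm110DecompTransport` (r5, AS
TYPED), the two deck relations, `Prop15ii` α β} at anchored standard data.
HONEST FRAMING: typed ≠ proved for [EtTh]; named inputs BY NAME; nothing here bears on [IUTchIII] Cor. 3.12.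
-/

noncomputable section

namespace Literature.AnabelianGeometry.EtaleTheta

open Literature.AnabelianGeometry.SemiGraphs

variable {p : ℕ} [Fact p.Prime]

/-! ## §A. Subgroup bookkeeping: conjugates and images -/

section Subgroups

variable {G G' : Type*} [Group G] [Group G']

/-- `γ(e⁻¹ K e) = γ(e)⁻¹ γ(K) γ(e)`. [folklore] -/
private theorem Subgroup.map_comap_conj_eq_comap_conj_map (K : Subgroup G) (γ : G ≃* G') (e : G) :
    (K.comap (MulAut.conj e).toMonoidHom).map γ.toMonoidHom =
      (K.map γ.toMonoidHom).comap (MulAut.conj (γ e)).toMonoidHom := by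
  ext k
  simp only [Subgroup.mem_map, Subgroup.mem_comap, MulEquiv.coe_toMonoidHom, MulAut.conj_apply]
  constructor
  · rintro ⟨j, hj, rfl⟩
    exact ⟨e * j * e⁻¹, hj, by rw [map_mul, map_mul, map_inv]⟩
  · rintro ⟨m, hm, hmk⟩
    refine ⟨γ.symm k, ?_, γ.apply_symm_apply k⟩
    have : e * γ.symm k * e⁻¹ = m := γ.injective (by
      rw [map_mul, map_mul, map_inv, γ.apply_symm_apply, hmk])
    rw [this]
    exact hm

omit [Group G'] in
/-- `u⁻¹ (t L t⁻¹) u = (u⁻¹t) L (u⁻¹t)⁻¹`. [folklore] -/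
private theorem Subgroup.comap_conj_map_conj (L : Subgroup G) (t u : G) :
    (L.map (MulAut.conj t).toMonoidHom).comap (MulAut.conj u).toMonoidHom =
      L.map (MulAut.conj (u⁻¹ * t)).toMonoidHom := by
  ext k
  simp only [Subgroup.mem_map, Subgroup.mem_comap, MulEquiv.coe_toMonoidHom, MulAut.conj_apply]
  constructor
  · rintro ⟨m, hm, hmk⟩
    exact ⟨m, hm, by rw [mul_inv_rev, inv_inv, ← mul_assoc, mul_assoc u⁻¹, mul_assoc u⁻¹, hmk]; group⟩
  · rintro ⟨m, hm, rfl⟩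
    exact ⟨m, hm, by group⟩

omit [Group G'] in
/-- `e⁻¹ L e` as an image: `L.comap (conj e) = L.map (conj e⁻¹)`. [folklore] -/
private theorem Subgroup.comap_conj_eq_map_conj_inv (L : Subgroup G) (e : G) :
    L.comap (MulAut.conj e).toMonoidHom = L.map (MulAut.conj e⁻¹).toMonoidHom := by
  ext k
  simp only [Subgroup.mem_map, Subgroup.mem_comap, MulEquiv.coe_toMonoidHom, MulAut.conj_apply, inv_inv]
  constructor
  · intro hk
    exact ⟨e * k * e⁻¹, hk, by group⟩
  · rintro ⟨m, hm, rfl⟩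
    simpa [mul_assoc] using hm

omit [Group G'] in
/-- `b (a L a⁻¹) b⁻¹ = (ba) L (ba)⁻¹`. [folklore] -/
private theorem Subgroup.map_conj_map_conj (L : Subgroup G) (a b : G) :
    (L.map (MulAut.conj a).toMonoidHom).map (MulAut.conj b).toMonoidHom =
      L.map (MulAut.conj (b * a)).toMonoidHom := by
  rw [Subgroup.map_map]
  congr 1
  ext k
  simp [MulAut.conj_apply, mul_assoc]

end Subgroups

namespace MuTwoSetting

variable {M : MuTwoSetting p}

/-! ## §B. The deck element is non-trivial modulo `Π^tp_Ÿ`; index-2 consequences -/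

/-- **An anchored `τ⁻¹` cannot sit on a `Π^tp_Ÿ`-conjugate of `D_τ`**: under the deck relation
`D_{τ⁻¹} = ε⁻¹ D_τ ε`, the element `ε` is NOT in `Π^tp_Ÿ` — otherwise `ε` acts trivially on `H¹(Π^tp_Ÿ, Δ_Θ)`,
the two anchored points evaluate `log(Ü)` identically (`evalAt_tauInv_eq_of_deck`), so `Ü(τ⁻¹) = Ü(τ)`, i.e.
`(√−1)⁻¹ = √−1`, `−1 = (√−1)² = 1`. [cite: MochizukiEtTh2009, Def 1.9 p.29] -/
theorem AnchoredStandardData.deck_not_mem_GtpYdd (hC : M.toThetaSetting.Compat)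
    {E : M.toThetaSetting.KummerData} (h15ii : ThetaSetting.Prop15ii E hC) (A : M.AnchoredStandardData E)
    {ε : M.PiTemp} (hD : A.tauInv.Dpt = A.tau.Dpt.comap (MulAut.conj ε).toMonoidHom) :
    ε ∉ M.GtpYdd := by
  intro hε
  haveI := hC.GtpYdd_normal
  have h := A.evalAt_tauInv_eq_of_deck hC h15ii hD (M.toThetaSetting.inflTheta M.GtpYdd E.logUdd)
  rw [ContH1.conj_eq_self_of_mem ε hε, A.tauInv.evalAt_logUdd, A.tau.evalAt_logUdd] at h
  have hc : ((A.tauInv.coord : M.Kdd) : PadicAlgCl p) = ((A.tau.coord : M.Kdd) : PadicAlgCl p) := by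
    rw [E.toKddHat_injective h]
  rw [A.tauInv_coord, A.tau_coord] at hc
  have hsq := A.sqrtNegOne_sq
  have h0 : A.sqrtNegOne ≠ 0 := fun h0 => by rw [h0] at hsq; norm_num at hsq
  have h1 : A.sqrtNegOne ^ 2 = 1 := by
    rw [sq]
    nth_rw 1 [← hc]
    exact inv_mul_cancel₀ h0
  rw [h1] at hsq
  have h2 : (2 : PadicAlgCl p) = 0 := by linear_combination hsq
  exact two_ne_zero h2

/-- `[Π^tp_Y : Π^tp_Ÿ] = 2` (`K = K̈`): an element of `toZ`-degree `0` squares into `Π^tp_Ÿ`.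
[cite: MochizukiEtTh2009, Def 2.7 p.41] -/
theorem mul_self_mem_GtpYdd_of_toZ {ε : M.PiTemp} (hε : M.toZ ε = 1) : ε * ε ∈ M.GtpYdd := by
  have hY : ε ∈ M.GtpY := hε
  have h := Subgroup.mul_self_mem_of_index_two (H := M.GtpYdd.subgroupOf M.GtpY)
    M.relIndex_GtpYdd_GtpY ⟨ε, hY⟩
  rw [Subgroup.mem_subgroupOf] at h
  exact h

/-- … and the product of two degree-`0` elements NOT in `Π^tp_Ÿ` lies in `Π^tp_Ÿ`.
[cite: MochizukiEtTh2009, Def 2.7 p.41] -/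
theorem mul_mem_GtpYdd_of_not_mem {a b : M.PiTemp} (ha : M.toZ a = 1) (hb : M.toZ b = 1)
    (ha' : a ∉ M.GtpYdd) (hb' : b ∉ M.GtpYdd) : a * b ∈ M.GtpYdd := by
  have h := (Subgroup.mul_mem_iff_of_index_two (H := M.GtpYdd.subgroupOf M.GtpY)
    M.relIndex_GtpYdd_GtpY (a := ⟨a, ha⟩) (b := ⟨b, hb⟩)).mpr
    (by simp only [Subgroup.mem_subgroupOf]; exact ⟨fun h => absurd h ha', fun h => absurd h hb'⟩)
  rw [Subgroup.mem_subgroupOf] at h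
  exact h

end MuTwoSetting

section Thm110

variable {Mα Mβ : MuTwoSetting p} {εα : Mα.GtpC} {εβ : Mβ.GtpC} {hCα : Mα.toThetaSetting.Compat}
  {hCβ : Mβ.toThetaSetting.Compat} {Eα : Mα.toThetaSetting.EtaleThetaData}
  {Eβ : Mβ.toThetaSetting.EtaleThetaData} {γ : Mα.dotC εα ≃ₜ* Mβ.dotC εβ}

/-- Under Thm. 1.6 (i) for `γ_X`: a degree-`0` element NOT in `Π^tp_{Ÿα}` goes to a degree-`0` element NOT in
`Π^tp_{Ÿβ}` (`γ(Π^tp_{Ÿα}) = Π^tp_{Ÿβ}`, and `ε² ∈ Π^tp_Ÿ` forces `2·toZ(γ ε) = 0`).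
[cite: MochizukiEtTh2009, Thm 1.6 (i) p.24] -/
theorem Thm110Hypothesis.toZ_γX_eq_one_and_not_mem (H : Thm110Hypothesis εα εβ hCα hCβ Eα Eβ γ)
    {ε : Mα.PiTemp} (hε : Mα.toZ ε = 1) (hε' : ε ∉ Mα.GtpYdd) :
    Mβ.toZ (H.γX.toMulEquiv ε) = 1 ∧ H.γX.toMulEquiv ε ∉ Mβ.GtpYdd := by
  have h16 : Mα.GtpYdd.map H.γX.toMulEquiv.toMonoidHom = Mβ.GtpYdd := H.thm16i
  constructor
  · have hsq : H.γX.toMulEquiv ε * H.γX.toMulEquiv ε ∈ Mβ.GtpYdd := by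
      rw [← map_mul, ← h16]
      exact ⟨ε * ε, MuTwoSetting.mul_self_mem_GtpYdd_of_toZ hε, rfl⟩
    have h2 : Mβ.toZ (H.γX.toMulEquiv ε) * Mβ.toZ (H.γX.toMulEquiv ε) = 1 := by
      rw [← map_mul]; exact Mβ.GtpYdd_le_GtpY hsq
    have h3 := congrArg Multiplicative.toAdd h2
    rw [toAdd_mul, toAdd_one] at h3
    have h4 : Multiplicative.toAdd (Mβ.toZ (H.γX.toMulEquiv ε)) = 0 := by omega
    exact toAdd_eq_zero.mp h4
  · rintro hmem
    rw [← h16] at hmem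
    obtain ⟨d, hd, hdε⟩ := hmem
    have : d = ε := H.γX.toMulEquiv.injective (by simpa using hdε)
    exact hε' (this ▸ hd)

/-- **The matching of `τ⁻¹` from that of `τ` and the two deck relations** (see the module docstring):
`Thm110DecompTransport H Sα Sβ` (row r5, as typed) and `D_{τ☐⁻¹} = ε☐⁻¹ D_{τ☐} ε☐` on both sides give the
full matching hypothesis of `thm110i_of_matching`. [cite: MochizukiEtTh2009, Thm 1.10 p.29] -/
theorem Thm110Hypothesis.matching_of_deck (H : Thm110Hypothesis εα εβ hCα hCβ Eα Eβ γ)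
    (Aα : Mα.AnchoredStandardData Eα.toKummerData) (Aβ : Mβ.AnchoredStandardData Eβ.toKummerData)
    (h15iiα : ThetaSetting.Prop15ii Eα.toKummerData hCα)
    (h15iiβ : ThetaSetting.Prop15ii Eβ.toKummerData hCβ)
    (hτ : Thm110DecompTransport H Aα.toStandardData Aβ.toStandardData)
    {eα : Mα.PiTemp} (heα : Mα.toZ eα = 1)
    (hDα : Aα.tauInv.Dpt = Aα.tau.Dpt.comap (MulAut.conj eα).toMonoidHom)
    {eβ : Mβ.PiTemp} (heβ : Mβ.toZ eβ = 1)
    (hDβ : Aβ.tauInv.Dpt = Aβ.tau.Dpt.comap (MulAut.conj eβ).toMonoidHom) :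
    ∃ σ σ' : Mβ.PiTemp, Mβ.inclX σ ∈ Mβ.dotX εβ ∧ Mβ.inclX σ' ∈ Mβ.dotX εβ ∧
      ((Aα.tau.Dpt.map H.γX.toMulEquiv.toMonoidHom = Aβ.tau.Dpt.map (MulAut.conj σ).toMonoidHom ∧
          Aα.tauInv.Dpt.map H.γX.toMulEquiv.toMonoidHom =
            Aβ.tauInv.Dpt.map (MulAut.conj σ').toMonoidHom) ∨
        (Aα.tau.Dpt.map H.γX.toMulEquiv.toMonoidHom = Aβ.tauInv.Dpt.map (MulAut.conj σ).toMonoidHom ∧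
          Aα.tauInv.Dpt.map H.γX.toMulEquiv.toMonoidHom =
            Aβ.tau.Dpt.map (MulAut.conj σ').toMonoidHom)) := by
  haveI := hCβ.GtpYdd_normal
  -- the deck elements are non-trivial modulo `Π^tp_Ÿ`, so is `γ(eα)`, which has degree 0
  have hnα : eα ∉ Mα.GtpYdd := Aα.deck_not_mem_GtpYdd hCα h15iiα hDα
  have hnβ : eβ ∉ Mβ.GtpYdd := Aβ.deck_not_mem_GtpYdd hCβ h15iiβ hDβ
  obtain ⟨hgZ, hgn⟩ := H.toZ_γX_eq_one_and_not_mem heα hnα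
  obtain ⟨σ, hσ, hcase⟩ := hτ
  -- `c = σ⁻¹ γ(eα)⁻¹ σ` : degree 0, not in `Π^tp_Ÿ`
  have hcZ : Mβ.toZ (σ⁻¹ * (H.γX.toMulEquiv eα)⁻¹ * σ) = 1 := by
    rw [map_mul, map_mul, map_inv, map_inv, hgZ, inv_one, mul_one, inv_mul_cancel]
  have hcn : σ⁻¹ * (H.γX.toMulEquiv eα)⁻¹ * σ ∉ Mβ.GtpYdd := fun hc => hgn (by
    have h' := (hCβ.GtpYdd_normal).conj_mem _ hc σ
    have h'' : (H.γX.toMulEquiv eα)⁻¹ ∈ Mβ.GtpYdd := by simpa [mul_assoc] using h'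
    simpa using Mβ.GtpYdd.inv_mem h'')
  have heβZ' : Mβ.toZ eβ⁻¹ = 1 := by rw [map_inv, heβ, inv_one]
  have hnβ' : eβ⁻¹ ∉ Mβ.GtpYdd := fun h => hnβ (by simpa using Mβ.GtpYdd.inv_mem h)
  -- `s = σ · (c · eβ^{±1})` lies over `Ẋβ`
  have hover : ∀ e : Mβ.PiTemp, Mβ.toZ e = 1 → e ∉ Mβ.GtpYdd →
      Mβ.inclX ((H.γX.toMulEquiv eα)⁻¹ * σ * e) ∈ Mβ.dotX εβ := fun e heZ hen => by
    have hprod : σ⁻¹ * (H.γX.toMulEquiv eα)⁻¹ * σ * e ∈ Mβ.GtpYdd :=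
      MuTwoSetting.mul_mem_GtpYdd_of_not_mem hcZ heZ hcn hen
    have hX : Mβ.inclX (σ⁻¹ * (H.γX.toMulEquiv eα)⁻¹ * σ * e) ∈ Mβ.dotX εβ :=
      Mβ.map_GtpXdd_le_dotX εβ ⟨_, Mβ.GtpYdd_le_GtpXdd hprod, rfl⟩
    have := (Mβ.dotX εβ).mul_mem hσ hX
    simpa [map_mul, map_inv, mul_assoc] using this
  -- the subgroup identity
  have hLHS : Aα.tauInv.Dpt.map H.γX.toMulEquiv.toMonoidHom =
      (Aα.tau.Dpt.map H.γX.toMulEquiv.toMonoidHom).comap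
        (MulAut.conj (H.γX.toMulEquiv eα)).toMonoidHom := by
    rw [hDα]
    exact Subgroup.map_comap_conj_eq_comap_conj_map Aα.tau.Dpt H.γX.toMulEquiv eα
  rcases hcase with hτ1 | hτ1
  · have hτ1' : Aα.tau.Dpt.map H.γX.toMulEquiv.toMonoidHom =
        Aβ.tau.Dpt.map (MulAut.conj σ).toMonoidHom := hτ1
    refine ⟨σ, (H.γX.toMulEquiv eα)⁻¹ * σ * eβ, hσ, hover eβ heβ hnβ, Or.inl ⟨hτ1', ?_⟩⟩
    rw [hLHS, hτ1', Subgroup.comap_conj_map_conj, hDβ, Subgroup.comap_conj_eq_map_conj_inv,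
      Subgroup.map_conj_map_conj, mul_inv_cancel_right]
  · have hτ1' : Aα.tau.Dpt.map H.γX.toMulEquiv.toMonoidHom =
        Aβ.tauInv.Dpt.map (MulAut.conj σ).toMonoidHom := hτ1
    refine ⟨σ, (H.γX.toMulEquiv eα)⁻¹ * σ * eβ⁻¹, hσ, hover eβ⁻¹ heβZ' hnβ', Or.inr ⟨hτ1', ?_⟩⟩
    rw [hLHS, hτ1', Subgroup.comap_conj_map_conj, hDβ, Subgroup.comap_conj_eq_map_conj_inv,
      Subgroup.map_conj_map_conj]

/-- **Thm. 1.10 (ii) (F-0514) from the TYPED row r5 and the deck relations** (+ `Thm110DeltaInduced`,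
Prop. 1.5 (ii) on both sides, anchored data). [cite: MochizukiEtTh2009, Thm 1.10 (ii) p.30] -/
theorem thm110ii_of_decompTransport_of_deck (H : Thm110Hypothesis εα εβ hCα hCβ Eα Eβ γ)
    (Aα : Mα.AnchoredStandardData Eα.toKummerData) (Aβ : Mβ.AnchoredStandardData Eβ.toKummerData)
    (h15iiα : ThetaSetting.Prop15ii Eα.toKummerData hCα)
    (h15iiβ : ThetaSetting.Prop15ii Eβ.toKummerData hCβ)
    (δ : (↥Mα.Kdd)ˣ ≃* (↥Mβ.Kdd)ˣ) (hδ : Thm110DeltaInduced H δ)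
    (hτ : Thm110DecompTransport H Aα.toStandardData Aβ.toStandardData)
    {eα : Mα.PiTemp} (heα : Mα.toZ eα = 1)
    (hDα : Aα.tauInv.Dpt = Aα.tau.Dpt.comap (MulAut.conj eα).toMonoidHom)
    {eβ : Mβ.PiTemp} (heβ : Mβ.toZ eβ = 1)
    (hDβ : Aβ.tauInv.Dpt = Aβ.tau.Dpt.comap (MulAut.conj eβ).toMonoidHom) :
    Thm110ii H Aα.toStandardData Aβ.toStandardData :=
  thm110ii_of_matching H Aα Aβ h15iiα h15iiβ δ hδ
    (H.matching_of_deck Aα Aβ h15iiα h15iiβ hτ heα hDα heβ hDβ)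

/-- **Thm. 1.10 (i) (F-0512) from the TYPED row r5 and the deck relations** (+ `Thm110DeltaInduced`,
`Thm110DeltaCompat`, Prop. 1.5 (ii) on both sides, anchored data). [cite: MochizukiEtTh2009, Thm 1.10 (i) p.29] -/
theorem thm110i_of_decompTransport_of_deck (H : Thm110Hypothesis εα εβ hCα hCβ Eα Eβ γ)
    (Aα : Mα.AnchoredStandardData Eα.toKummerData) (Aβ : Mβ.AnchoredStandardData Eβ.toKummerData)
    (h15iiα : ThetaSetting.Prop15ii Eα.toKummerData hCα)
    (h15iiβ : ThetaSetting.Prop15ii Eβ.toKummerData hCβ)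
    (δ : (↥Mα.Kdd)ˣ ≃* (↥Mβ.Kdd)ˣ) (hδ : Thm110DeltaInduced H δ)
    (hcompat : Thm110DeltaCompat (Mα := Mα) (Mβ := Mβ) δ)
    (hτ : Thm110DecompTransport H Aα.toStandardData Aβ.toStandardData)
    {eα : Mα.PiTemp} (heα : Mα.toZ eα = 1)
    (hDα : Aα.tauInv.Dpt = Aα.tau.Dpt.comap (MulAut.conj eα).toMonoidHom)
    {eβ : Mβ.PiTemp} (heβ : Mβ.toZ eβ = 1)
    (hDβ : Aβ.tauInv.Dpt = Aβ.tau.Dpt.comap (MulAut.conj eβ).toMonoidHom) :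
    Thm110i H Aα.toStandardData Aβ.toStandardData :=
  thm110i_of_matching H Aα Aβ h15iiα h15iiβ δ hδ hcompat
    (H.matching_of_deck Aα Aβ h15iiα h15iiβ hτ heα hDα heβ hDβ)

end Thm110

end Literature.AnabelianGeometry.EtaleTheta

end
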